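import Mathlib

/-!
# Crux `ExactCertificate` (stmt-AtomisticToContinuum-11959), line `closure-makes-nogap-exact`,
# Transfer skeleton V (`OneCrossingChainCertificate`): stub `stub_classCrossing`

Support file for the crux `ThreeConeCertificate.ExactCertificate`, d = 1 transfer skeleton V
(`Cruxes.ExactCertificate.Transfer1D.OneCrossingChainCertificate`).  This file proves the
registered stub `stub_classCrossing`, the class form of `stub_crossing`
(file `…Transfer1DCrossing.lean`): the one sign change of an abstract Laplace density `p`
against an antitone weight.

With `p ≥ 0` on `(0, t₀]`, `p ≤ 0` on `[t₀, ∞)` and `b = (k+1) a > 0`: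

* `classCrossing_integrand_sub_nonneg` — for `h` antitone on `(0, ∞)` and `t > 0`,
  `e^{−tb} p(t) (t h t) − h(t₀) (e^{−tb} p(t) t) = e^{−tb} p(t) t (h t − h t₀) ≥ 0`
  (both factors change sign at `t₀`, in opposite directions);
* `classCrossing_moment_mul_le_integral` — hence
  `h(t₀) ∫₀^∞ e^{−tb} p(t) t dt ≤ ∫₀^∞ e^{−tb} p(t) (t h t) dt`;
* **`stub_classCrossing`** — summing with weights `k + 1` against the zero-pressure identity
  `Σ_k (k+1) ∫₀^∞ e^{−t(k+1)a} p(t) t dt = 0`: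
  `0 = h(t₀) · 0 ≤ Σ_k (k+1) ∫₀^∞ e^{−t(k+1)a} p(t) (t h t) dt`.

All `[folklore]` (sign-change / variation-diminishing bookkeeping for Laplace transforms,
cf. Pólya–Szegő, *Aufgaben und Lehrsätze* II, Part V); no named facts are used.
-/

noncomputable section

namespace Summit.AtomisticToContinuum.Crystallization.Theorems.ThreeConeCertificateExactCertificate.Transfer1D

open MeasureTheory Set Filter Topology
open scoped BigOperators

/-! ## One sign change against an antitone weight -/

/-- **Pointwise sign.** For `p ≥ 0` on `(0, t₀]`, `p ≤ 0` on `[t₀, ∞)` (`t₀ > 0`), `h` antitone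
on `(0, ∞)`, any real `b` and `t > 0`:
`e^{−tb} p(t) (t h(t)) − h(t₀) (e^{−tb} p(t) t) = e^{−tb} p(t) t (h t − h t₀) ≥ 0`,
since `p t` and `h t − h t₀` are both `≥ 0` for `t ≤ t₀` and both `≤ 0` for `t ≥ t₀`.
[folklore] -/
theorem classCrossing_integrand_sub_nonneg {p : ℝ → ℝ} {t₀ : ℝ} (ht₀ : 0 < t₀)
    (hpos : ∀ t : ℝ, 0 < t → t ≤ t₀ → 0 ≤ p t) (hneg : ∀ t : ℝ, t₀ ≤ t → p t ≤ 0)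
    {h : ℝ → ℝ} (hh : AntitoneOn h (Ioi 0)) (b : ℝ) {t : ℝ} (ht : 0 < t) :
    0 ≤ Real.exp (-(t * b)) * p t * (t * h t) - h t₀ * (Real.exp (-(t * b)) * p t * t) := by
  have hexp : 0 ≤ Real.exp (-(t * b)) := (Real.exp_pos _).le
  have key : 0 ≤ Real.exp (-(t * b)) * p t * t * (h t - h t₀) := by
    rcases le_total t t₀ with hle | hle
    · -- below the crossing: `p t ≥ 0` and `h t₀ ≤ h t`
      have hp0 : 0 ≤ p t := hpos t ht hle
      have hh0 : 0 ≤ h t - h t₀ := sub_nonneg.2 (hh ht ht₀ hle)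
      exact mul_nonneg (mul_nonneg (mul_nonneg hexp hp0) ht.le) hh0
    · -- above the crossing: `p t ≤ 0` and `h t ≤ h t₀`
      have hp0 : 0 ≤ -p t := neg_nonneg.2 (hneg t hle)
      have hh0 : 0 ≤ h t₀ - h t := sub_nonneg.2 (hh ht₀ ht hle)
      have := mul_nonneg (mul_nonneg (mul_nonneg hexp hp0) ht.le) hh0
      exact this.trans_eq (by ring)
  exact key.trans_eq (by ring)

/-- **Moment comparison.** For `p ≥ 0` on `(0, t₀]`, `p ≤ 0` on `[t₀, ∞)` (`t₀ > 0`), `h` antitone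
on `(0, ∞)`, any real `b` with `e^{−tb} p(t) t` and `e^{−tb} p(t) (t h(t))` integrable on `(0, ∞)`:
`h(t₀) ∫₀^∞ e^{−tb} p(t) t dt ≤ ∫₀^∞ e^{−tb} p(t) (t h(t)) dt`
(integrate `classCrossing_integrand_sub_nonneg`). [folklore] -/
theorem classCrossing_moment_mul_le_integral {p : ℝ → ℝ} {t₀ : ℝ} (ht₀ : 0 < t₀)
    (hpos : ∀ t : ℝ, 0 < t → t ≤ t₀ → 0 ≤ p t) (hneg : ∀ t : ℝ, t₀ ≤ t → p t ≤ 0)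
    {h : ℝ → ℝ} (hh : AntitoneOn h (Ioi 0)) {b : ℝ}
    (hintM : IntegrableOn (fun t : ℝ => Real.exp (-(t * b)) * p t * t) (Ioi 0))
    (hint : IntegrableOn (fun t : ℝ => Real.exp (-(t * b)) * p t * (t * h t)) (Ioi 0)) :
    h t₀ * (∫ t in Ioi (0 : ℝ), Real.exp (-(t * b)) * p t * t)
      ≤ ∫ t in Ioi (0 : ℝ), Real.exp (-(t * b)) * p t * (t * h t) := by
  have hgi := hintM.const_mul (h t₀)
  have hdiff : 0 ≤ ∫ t in Ioi (0 : ℝ), (Real.exp (-(t * b)) * p t * (t * h t)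
      - h t₀ * (Real.exp (-(t * b)) * p t * t)) :=
    setIntegral_nonneg measurableSet_Ioi fun t ht =>
      classCrossing_integrand_sub_nonneg ht₀ hpos hneg hh b ht
  rw [integral_sub hint hgi, integral_const_mul] at hdiff
  linarith

/-! ## The registered stub -/

/-- **`stub_classCrossing`** — ONE SIGN CHANGE AGAINST AN ANTITONE WEIGHT (registered stub of
Transfer skeleton V of line `closure-makes-nogap-exact`; class form of `stub_crossing`).
If `p ≥ 0` on `(0, t₀]`, `p ≤ 0` on `[t₀, ∞)` and, for `a > 0`, the `(k+1)`-weighted first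
moments `M_k = ∫₀^∞ e^{−t(k+1)a} p(t) t dt` sum to zero (zero pressure, `Σ_k (k+1) M_k = 0`), then
for every `h` antitone on `(0, ∞)` (integrands integrable, series summable)
`0 ≤ Σ_k (k+1) ∫₀^∞ e^{−t(k+1)a} p(t) t h(t) dt`.  Termwise
`h(t₀) (k+1) M_k ≤ (k+1) ∫₀^∞ e^{−t(k+1)a} p(t) t h(t) dt`
(`classCrossing_moment_mul_le_integral`), and the left-hand sides sum to `h(t₀) · 0 = 0`.
[folklore] -/
theorem stub_classCrossing : ∀ (p : ℝ → ℝ) (t₀ : ℝ), 0 < t₀ →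
    (∀ t : ℝ, 0 < t → t ≤ t₀ → 0 ≤ p t) → (∀ t : ℝ, t₀ ≤ t → p t ≤ 0) →
    ∀ a : ℝ, 0 < a →
    (∀ k : ℕ, IntegrableOn (fun t : ℝ => Real.exp (-(t * (((k : ℝ) + 1) * a))) * p t * t) (Set.Ioi 0)) →
    HasSum (fun k : ℕ => ((k : ℝ) + 1) *
      ∫ t in Set.Ioi (0 : ℝ), Real.exp (-(t * (((k : ℝ) + 1) * a))) * p t * t) 0 →
    ∀ h : ℝ → ℝ, AntitoneOn h (Set.Ioi 0) →
    (∀ k : ℕ, IntegrableOn (fun t : ℝ => Real.exp (-(t * (((k : ℝ) + 1) * a))) * p t * (t * h t)) (Set.Ioi 0)) →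
    Summable (fun k : ℕ => ((k : ℝ) + 1) *
      ∫ t in Set.Ioi (0 : ℝ), Real.exp (-(t * (((k : ℝ) + 1) * a))) * p t * (t * h t)) →
    0 ≤ ∑' k : ℕ, ((k : ℝ) + 1) *
      ∫ t in Set.Ioi (0 : ℝ), Real.exp (-(t * (((k : ℝ) + 1) * a))) * p t * (t * h t) := by
  intro p t₀ ht₀ hpos hneg a _ hintM hz h hh hint hsum
  have hterm : ∀ k : ℕ,
      h t₀ * (((k : ℝ) + 1) *
        ∫ t in Set.Ioi (0 : ℝ), Real.exp (-(t * (((k : ℝ) + 1) * a))) * p t * t)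
        ≤ ((k : ℝ) + 1) *
          ∫ t in Set.Ioi (0 : ℝ), Real.exp (-(t * (((k : ℝ) + 1) * a))) * p t * (t * h t) := by
    intro k
    have hk : (0 : ℝ) ≤ (k : ℝ) + 1 := by positivity
    have hle := classCrossing_moment_mul_le_integral ht₀ hpos hneg hh (hintM k) (hint k)
    calc h t₀ * (((k : ℝ) + 1) *
          ∫ t in Set.Ioi (0 : ℝ), Real.exp (-(t * (((k : ℝ) + 1) * a))) * p t * t)
        = ((k : ℝ) + 1) * (h t₀ *
          ∫ t in Set.Ioi (0 : ℝ), Real.exp (-(t * (((k : ℝ) + 1) * a))) * p t * t) := by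
          ring
      _ ≤ _ := mul_le_mul_of_nonneg_left hle hk
  have hR : HasSum (fun k : ℕ => h t₀ * (((k : ℝ) + 1) *
      ∫ t in Set.Ioi (0 : ℝ), Real.exp (-(t * (((k : ℝ) + 1) * a))) * p t * t)) 0 := by
    have := hz.mul_left (h t₀)
    rwa [mul_zero] at this
  exact hasSum_le hterm hR hsum.hasSum

end Summit.AtomisticToContinuum.Crystallization.Theorems.ThreeConeCertificateExactCertificate.Transfer1D

end
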